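import Summits.BirchSwinnertonDyer.BirchSwinnertonDyer.Theorems.ByReductionTypeAtTwoTorsionEulerCharGoodOrd
import Summits.BirchSwinnertonDyer.BirchSwinnertonDyer.Theorems.ByReductionTypeAtTwoTorsionEulerCharCasselsGe
import HarnessLib

set_option linter.dupNamespace false -- `…BirchSwinnertonDyer.BirchSwinnertonDyer…` is the cell's nested layout (D-0017)
set_option autoImplicit false

/-!
# Greenberg LNM 1716 Theorem 4.1 over `ℚ` WITH RATIONAL `p`-TORSION — the TWO-SIDED (unit) form, EXACTLY modulo the
# displayed REVERSE INEQUALITY of Lemma 4.7 at one auxiliary place (good ordinary `p`, and the non-split multiplicative analogue)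

Cell `bsd-2adic` (run/shared/lean/pub/bsd-2adic/), seat `bsd-2adic-tower-1` GEN 33; `--supports stmt-BirchSwinnertonDyer-19271`
(helper for the GOOD-ORDINARY rows at `2` WITH a rational `2`-torsion point, whose doors display `hEC : X5.O1.TwoAdicEulerCharRankZero
W 0`). THEOREMS ONLY (no definition, no named fact, no `sorry`); closes no item; nothing booked; no display re-keyed (D-0152); BSD
is not proved by any of this.

R. Greenberg, *Iwasawa theory for elliptic curves*, LNM 1716 (1999), Thm. 4.1 (p. 102) and its multiplicative analogue (p. 112):
`f_E(0) ∼ (∏_v l_v c_v^{(p)}) (∏_{v∣p} |Ẽ_v(f_v)_p|²) |Sel_E(F)_p| / |E(F)_p|²`. With `E(F)_p ≠ 0` the printed proof is Lemmas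
4.2/4.3 × Lemma 4.7 `|ker g|·|E(F)_p| = |ker r|·|(Sel_E(F_∞)_p)_Γ|` × Cassels' count `[𝒫^Σ(F) : 𝒢^Σ(F)] = |E(F)_p|`. In the tree:
Lemmas 4.2/4.3 (`SelmerDualData.constantCoeff_charGenerator_mul_natCard_of_finite_selmerGroup_rat`), the «`≥`» half of Lemma 4.7
(GEN 31 part 3c `prod_natCard_mul_natCard_endCoinvariants_le`) and Cassels' count at one auxiliary place `v₀` WITH torsion
(GEN 32 part 11 `natCard_cokernel_eq`: `#C_{v₀} = #E(K)(p)`, `C_{v₀} = H¹(Γ_{K_{v₀}}, E)(p) / loc_{v₀}(U)`) are KERNEL theorems for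
every `p`. The «`≤`» half of Lemma 4.7,

  «REV(W, p, κ, γ, S, v₀)»: `#(A₀/Sel₀) · #C_{v₀} ≤ (∏_{v ∈ S} #𝒦_{v,0}[p^∞]) · #(Sel_{p^∞}(E/ℚ_∞))_γ`,

is Greenberg's map `t` (GEN 32 parts 7–9) and needs his Lemma 4.6 on `Γ`-invariants at `v₀` (the displayed binder `h46` of part
9, `…TorsionEulerCharReverse`). THIS FILE is the G-INDEPENDENT assembly: it takes REV itself as a DISPLAYED HYPOTHESIS `hrev` (a
numerical inequality between orders of finite groups, in the verbatim currency of parts 3c/9/11) and proves the two-sided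
displays from it, so that part 9 (REV ⟸ h46) plugs in by name:

* `constantCoeff_mul_sq_eq_rat_of_reverse` — over `ℚ`, ANY reduction type at `p`: from «DIV», local surjectivity at every finite
  place, finiteness of the `𝒦_{v,0}` above `p`, and `hrev`: **`f(0)·#E(ℚ)(p)² = u·#Sel_{p^∞}(E/ℚ)·∏_{v∈S} #𝒦_{v,0}[p^∞]`, `u ∈ ℤ_pˣ`**;
* `constantCoeff_mul_sq_eq_ordinary_rat_of_reverse` — GOOD ORDINARY `p` (every input but `hrev` discharged: k4-p1 DIV / LOC_ord,
  Lemma 3.4 at `n = 0`);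
* `constantCoeff_mul_sq_eq_nonsplit_rat_of_reverse` — the NON-SPLIT multiplicative twin (GEN 29 local surjectivity, GEN 28
  finiteness of the `𝒦_{v,0}` above `p`).

The printed / `ℚ_p` / display currencies (`…_printed_of_reverse`, `charValue_rankZero_of_reverse`,
`twoAdicEulerCharRankZero_of_reverse`, the non-split `2^{ord₂ ∏ c + 1}` form and `twoAdicEulerCharRankZeroNonsplitMult_of_reverse`)
are in the sequel `…TorsionEulerCharExactOfReversePrinted`.

HONEST FRAMING: REV is NOT proved here (it is Lemma 4.7's «`≤`» half = Lemma 4.6 on `Γ`-invariants; part 9 derives it from the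
displayed `h46`); everything else is kernel-checked over tree theorems. Closes no item; no summit statement is proved; the
Birch–Swinnerton-Dyer conjecture is NOT proved by any of this.

References: [GreenbergLNM1716] Thm. 4.1 (p. 102), §3 Lemmas 3.3–3.4 (pp. 86–89), §4 pp. 104–108 (Lemmas 4.6–4.7), pp. 112–113,
Prop. 4.13 (pp. 121–122).
-/

noncomputable section

open scoped Classical NumberField

open NumberField IsDedekindDomain Field

namespace Summit.BirchSwinnertonDyer.BirchSwinnertonDyer.Theorems.TorsionEulerChar

open Literature.NumberTheory.EllipticCurves Literature.NumberTheory.GaloisRepresentations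
  WeierstrassCurve ZpExtension Literature.NumberTheory.EllipticCurves.IwasawaAlgebra
  Literature.NumberTheory.EllipticCurves.IwasawaDual
  Literature.NumberTheory.EllipticCurves.GreenbergVatsal2000 Literature.NumberTheory.EllipticCurves.GreenbergSelmer
  Literature.NumberTheory.EllipticCurves.Rank1Residual Summit.BirchSwinnertonDyer.Rank1Residual.X2

/-! ## §0 Arithmetic helpers (copies of the private helpers of parts 4/6/A) -/

/-- A finite additive group all of whose elements are killed by powers of `p` has `p`-power order (`IsPGroup.iff_card`).
[folklore] -/
private theorem exists_natCard_eq_pow (p : ℕ) [Fact p.Prime] {A : Type*} [AddCommGroup A] [Finite A]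
    (h : ∀ a : A, ∃ k : ℕ, p ^ k • a = 0) : ∃ n : ℕ, Nat.card A = p ^ n := by
  have hG : IsPGroup p (Multiplicative A) := fun g ↦ by
    obtain ⟨k, hk⟩ := h (Multiplicative.toAdd g)
    exact ⟨k, by rw [← ofAdd_toAdd g, ← ofAdd_nsmul, hk, ofAdd_zero]⟩
  obtain ⟨n, hn⟩ := (IsPGroup.iff_card (p := p) (G := Multiplicative A)).mp hG
  exact ⟨n, hn⟩

/-! ## §1 The two-sided count over `ℚ`, any reduction type at `p`, modulo the displayed reverse inequality -/

/-- **Greenberg's Thm. 4.1 / its multiplicative analogue over `ℚ`, ANY rational `p`-torsion — the TWO-SIDED count modulo the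
REVERSE INEQUALITY of Lemma 4.7 at one auxiliary place.** For `W/ℚ` globally minimal and elliptic, `κ` the CYCLOTOMIC
`ℤ_p`-extension with topological generator `γ`, `Sel_{p^∞}(E/ℚ)` finite, a Pontryagin-dual datum `D` with `char X(E/ℚ_∞) = (f)`,
«DIV» for `H¹(ℚ_∞, E[p^∞])` (`hdiv`), the local surjectivity `𝒫_E(ℚ_v)[p^∞] ↠ 𝒫_E(ℚ_{∞,η})[p^∞]^{Γ_v}` at every finite place
(`hsurj`), `𝒦_{v,0}[p^∞]` finite at the place above `p` (`hTp`), a finite `S ⊇ {bad} ∪ {p}`, an auxiliary `v₀ ∉ S`, and the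
REVERSE INEQUALITY `hrev : #(A₀/Sel₀) · #C_{v₀} ≤ (∏_{v∈S} #𝒦_{v,0}[p^∞]) · #(Sel_∞)_γ` at Cassels' cokernel
`C_{v₀} = H¹(Γ_{ℚ_{v₀}}, E)(p) / loc_{v₀}(U)` (Lemma 4.7 «`≤`», i.e. Lemma 4.6 on `Γ`-invariants — DISPLAYED, not proved):
`X` is finitely generated `Λ`-torsion and **`f(0) · #E(ℚ)(p)² = u · #Sel_{p^∞}(E/ℚ) · ∏_{v ∈ S} #𝒦_{v,0}[p^∞]` with `u ∈ ℤ_pˣ`.**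
(Lemmas 4.2/4.3 `f(0)·#(Sel_∞)_γ·#E(ℚ)(p) = u·#Sel·#(A₀/Sel₀)`; part 3c «`≥`»; part 11 `#C_{v₀} = #E(ℚ)(p)`; all orders are
powers of `p`, so the two inequalities give `a + b = c + d` on exponents.)
[cite: GreenbergLNM1716, Thm. 4.1 (p. 102), §4 p. 104 and Lemma 4.7 (pp. 107–108), pp. 112–113, Prop. 4.13 (p. 122)] -/
theorem constantCoeff_mul_sq_eq_rat_of_reverse (p : ℕ) [hp : Fact p.Prime] (W : WeierstrassCurve ℚ)
    [W.IsGloballyMinimal] [W.IsElliptic] (κ : ZpExtension ℚ p) (hκ : κ.IsCyclotomic)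
    {γ : absoluteGaloisGroup ℚ} (hγ : κ.IsTopGenerator γ) (D : W.SelmerDualData κ γ) [Finite (W.selmerGroupPInfty p)]
    (hdiv : ∀ s : W.subgroupH1 p κ.kerSubgroup,
      ∃ t : W.subgroupH1 p κ.kerSubgroup, W.conjH1 p κ.kerSubgroup γ t - t = s)
    (hsurj : ∀ (v : HeightOneSpectrum (𝓞 ℚ))
      (c : discreteH1 (localSubgroup κ.kerSubgroup (v.adicCompletion ℚ)) (localPoints W (v.adicCompletion ℚ))),
      (∃ k : ℕ, p ^ k • c = 0) →
      (∀ δ : absoluteGaloisGroup (v.adicCompletion ℚ),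
        Literature.NumberTheory.EllipticCurves.conjH1 (localSubgroup κ.kerSubgroup (v.adicCompletion ℚ))
          (localPoints W (v.adicCompletion ℚ)) δ c = c) →
      ∃ x : discreteH1 (localSubgroup (⊤ : Subgroup (absoluteGaloisGroup ℚ)) (v.adicCompletion ℚ))
          (localPoints W (v.adicCompletion ℚ)),
        (∃ k : ℕ, p ^ k • x = 0) ∧
        Literature.NumberTheory.EllipticCurves.resOfLe (localPoints W (v.adicCompletion ℚ))
          (Subgroup.comap_mono le_top :
            localSubgroup κ.kerSubgroup (v.adicCompletion ℚ) ≤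
              localSubgroup (⊤ : Subgroup (absoluteGaloisGroup ℚ)) (v.adicCompletion ℚ)) x = c)
    (hTp : ∀ v : HeightOneSpectrum (𝓞 ℚ), ((p : ℕ) : 𝓞 ℚ) ∈ v.asIdeal →
      Finite (W.localTowerKerPrimary κ (v.adicCompletion ℚ) 0))
    (S : Finset (HeightOneSpectrum (𝓞 ℚ))) (hS : ∀ v ∉ S, ((p : ℕ) : 𝓞 ℚ) ∉ v.asIdeal ∧ W.HasGoodReductionAt v)
    (v₀ : HeightOneSpectrum (𝓞 ℚ)) (hv₀ : v₀ ∉ S)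
    (hrev : Nat.card (W.KerG κ 0) *
        Nat.card (AddCommGroup.primaryComponent
            (discreteH1 (localSubgroup (⊤ : Subgroup (absoluteGaloisGroup ℚ)) (v₀.adicCompletion ℚ))
              (localPoints W (v₀.adicCompletion ℚ))) p ⧸
          (AddSubgroup.map (W.localResOver p ⊤ (v₀.adicCompletion ℚ))
            (unramifiedOutside (⊤ : Subgroup (absoluteGaloisGroup ℚ)) (W.geomPrimaryTorsion p) p
                ((↑S : Set (HeightOneSpectrum (𝓞 ℚ))) ∪ {v₀}) ⊓
              (⨅ v ∈ S, W.localKerOver p ⊤ (v.adicCompletion ℚ)) ⊓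
              (⨅ w : InfinitePlace ℚ, W.localKerOver p ⊤ w.Completion))).addSubgroupOf
            (AddCommGroup.primaryComponent
              (discreteH1 (localSubgroup (⊤ : Subgroup (absoluteGaloisGroup ℚ)) (v₀.adicCompletion ℚ))
                (localPoints W (v₀.adicCompletion ℚ))) p)) ≤
      (∏ v ∈ S, Nat.card (W.localTowerKerPrimary κ (v.adicCompletion ℚ) 0)) *
        Nat.card (EndCoinvariants (W.conjSelmerInfty κ γ - 1)))
    (f : IwasawaAlgebra p) (hf : Module.charIdeal (IwasawaAlgebra p) D.X = Ideal.span {f}) :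
    Module.Finite (IwasawaAlgebra p) D.X ∧ Module.IsTorsion (IwasawaAlgebra p) D.X ∧
      ∃ u : ℤ_[p]ˣ, PowerSeries.constantCoeff f *
          (Nat.card (AddCommGroup.primaryComponent W.toAffine.Point p) : ℤ_[p]) ^ 2 =
        (u : ℤ_[p]) * Nat.card (W.selmerGroupPInfty p) *
          ∏ v ∈ S, Nat.card (W.localTowerKerPrimary κ (v.adicCompletion ℚ) 0) := by
  -- adapted from `constantCoeff_mul_sq_eq_ordinary_rat_of_defect` (GEN 32 part A) with the receptacle specialised to Cassels'
  -- cokernel (EXACT count, part 11) and the reverse inequality `hrev` turning `a + b ≤ c + d` into an equality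
  classical
  have hprime : p.Prime := hp.out
  -- notation for Cassels' cokernel at `v₀`
  let Pv := discreteH1 (localSubgroup (⊤ : Subgroup (absoluteGaloisGroup ℚ)) (v₀.adicCompletion ℚ))
    (localPoints W (v₀.adicCompletion ℚ))
  let P₀ : AddSubgroup Pv := AddCommGroup.primaryComponent Pv p
  let L : AddSubgroup Pv := AddSubgroup.map (W.localResOver p ⊤ (v₀.adicCompletion ℚ))
    (unramifiedOutside (⊤ : Subgroup (absoluteGaloisGroup ℚ)) (W.geomPrimaryTorsion p) p
        ((↑S : Set (HeightOneSpectrum (𝓞 ℚ))) ∪ {v₀}) ⊓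
      (⨅ v ∈ S, W.localKerOver p ⊤ (v.adicCompletion ℚ)) ⊓
      (⨅ w : InfinitePlace ℚ, W.localKerOver p ⊤ w.Completion))
  obtain ⟨hfin, -⟩ := finite_and_natCard_cokernel_le W p S hS v₀ hv₀
  haveI : Finite (P₀ ⧸ L.addSubgroupOf P₀) := hfin
  -- Cassels' count with torsion, EXACT (part 11); the `DecidableEq ℚ` instances behind the two group laws on `E(ℚ)` are
  -- identified first
  have hdec : (fun a b : ℚ => Classical.propDecidable (a = b)) = instDecidableEqRat := Subsingleton.elim _ _
  have hCeq := natCard_cokernel_eq W p S hS v₀ hv₀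
  rw [hdec] at hCeq
  have hCeq' : Nat.card (P₀ ⧸ L.addSubgroupOf P₀) = Nat.card (AddCommGroup.primaryComponent W.toAffine.Point p) := hCeq
  -- finiteness of the local tower kernels on `S` and of `ker g₀`
  have hT : ∀ v ∈ S, Finite (W.localTowerKerPrimary κ (v.adicCompletion ℚ) 0) := fun v _ ↦ by
    by_cases hpv : ((p : ℕ) : 𝓞 ℚ) ∈ v.asIdeal
    · exact hTp v hpv
    · exact W.finite_localTowerKerPrimary_zero_of_not_mem κ hpv
  have hg : Finite (W.KerG κ 0) := W.finite_kerG_zero_of_finite_localTowerKerPrimary_dvd κ hTp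
  -- Lemmas 4.2/4.3: `f(0) · #(Sel_∞)_γ · #E[p^∞]^{Γ_ℚ} = u · #Sel · #(A₀/Sel₀)`
  obtain ⟨hFG, hX, -, hCofin, -, u, hu⟩ :=
    D.constantCoeff_charGenerator_mul_natCard_of_finite_selmerGroup_rat W hγ ‹_› hg f hf
  haveI := hCofin
  refine ⟨hFG, hX, ?_⟩
  -- Lemma 4.7, the «≥» half at Cassels' receptacle: `∏#𝒦 · #(Sel_∞)_γ ≤ #(A₀/Sel₀) · #C_{v₀}`
  have hineq := prod_natCard_mul_natCard_endCoinvariants_le W p κ hκ hγ ‹_› hdiv hsurj S hS v₀ hv₀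
    (QuotientAddGroup.mk' (L.addSubgroupOf P₀)) (fun z ↦ by
      rw [QuotientAddGroup.mk'_apply, QuotientAddGroup.eq_zero_iff, AddSubgroup.mem_addSubgroupOf]) hT
  -- the four orders are powers of `p`
  rw [natCard_fixedPoints_geomPrimaryTorsion_eq W p] at hu
  rw [hdec] at hu
  obtain ⟨hEfin, -⟩ := (W.finite_selmerGroupPInfty_iff p).mp ‹_›
  haveI := hEfin
  obtain ⟨a, ha⟩ : ∃ a : ℕ, ∏ v ∈ S, Nat.card (W.localTowerKerPrimary κ (v.adicCompletion ℚ) 0) = p ^ a := by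
    have hv : ∀ v ∈ S, ∃ a : ℕ, Nat.card (W.localTowerKerPrimary κ (v.adicCompletion ℚ) 0) = p ^ a := fun v hv ↦ by
      haveI := hT v hv
      exact exists_natCard_eq_pow p fun x ↦ by
        obtain ⟨-, k, hk⟩ := (W.mem_localTowerKerPrimary_iff κ _ 0 _).mp x.2
        exact ⟨k, Subtype.ext (by rw [AddSubgroupClass.coe_nsmul, hk, ZeroMemClass.coe_zero])⟩
    choose! e he using hv
    exact ⟨∑ v ∈ S, e v, by rw [← Finset.prod_pow_eq_pow_sum]; exact Finset.prod_congr rfl he⟩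
  obtain ⟨b, hb⟩ : ∃ b : ℕ, Nat.card (EndCoinvariants (W.conjSelmerInfty κ γ - 1)) = p ^ b :=
    exists_natCard_eq_pow p fun x ↦ by
      induction x using QuotientAddGroup.induction_on with
      | H s =>
        obtain ⟨k, hk⟩ := W.exists_pow_smul_subgroupH1_ker_eq_zero κ (s : W.subgroupH1 p κ.kerSubgroup)
        refine ⟨k, ?_⟩
        have hs : p ^ k • s = 0 := Subtype.ext (by rw [AddSubgroupClass.coe_nsmul, hk, ZeroMemClass.coe_zero])
        rw [← QuotientAddGroup.mk_nsmul, hs, QuotientAddGroup.mk_zero]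
  obtain ⟨c, hc⟩ : ∃ c : ℕ, Nat.card (W.KerG κ 0) = p ^ c :=
    exists_natCard_eq_pow p fun x ↦ by
      induction x using QuotientAddGroup.induction_on with
      | H y =>
        obtain ⟨k, hk⟩ := W.exists_pow_smul_subgroupH1_layer_eq_zero κ 0 (y : W.subgroupH1 p (κ.layerSubgroup 0))
        refine ⟨k, ?_⟩
        have hy : p ^ k • y = 0 := Subtype.ext (by rw [AddSubgroupClass.coe_nsmul, hk, ZeroMemClass.coe_zero])
        rw [← QuotientAddGroup.mk_nsmul, hy, QuotientAddGroup.mk_zero]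
  obtain ⟨d, hd⟩ : ∃ d : ℕ, Nat.card (AddCommGroup.primaryComponent W.toAffine.Point p) = p ^ d :=
    exists_natCard_eq_pow p fun P ↦ by
      obtain ⟨k, hk⟩ := (AddCommGroup.mem_primaryComponent).mp P.2
      exact ⟨k, Subtype.ext (by rw [AddSubgroupClass.coe_nsmul, hk, ZeroMemClass.coe_zero])⟩
  -- `a + b = c + d`
  have hle : a + b ≤ c + d := by
    have h := hineq
    rw [hCeq', ha, hb, hc, hd, ← pow_add, ← pow_add] at h
    exact (Nat.pow_le_pow_iff_right hprime.one_lt).mp h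
  have hge : c + d ≤ a + b := by
    have h := hrev
    rw [hCeq, ha, hb, hc, hd, ← pow_add, ← pow_add] at h
    exact (Nat.pow_le_pow_iff_right hprime.one_lt).mp h
  have habcd : c + d = a + b := le_antisymm hge hle
  -- multiply out in `ℤ_p`
  rw [hb, hd, hc] at hu
  push_cast at hu
  refine ⟨u, ?_⟩
  rw [ha, hd]
  push_cast
  have hb0 : ((p : ℤ_[p]) ^ b) ≠ 0 := pow_ne_zero _ (by exact_mod_cast hprime.ne_zero)
  have hpow : ((p : ℤ_[p]) ^ c) * (p : ℤ_[p]) ^ d = (p : ℤ_[p]) ^ a * (p : ℤ_[p]) ^ b := by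
    rw [← pow_add, ← pow_add, habcd]
  refine mul_right_cancel₀ hb0 ?_
  calc PowerSeries.constantCoeff f * ((p : ℤ_[p]) ^ d) ^ 2 * (p : ℤ_[p]) ^ b
      = (PowerSeries.constantCoeff f * (p : ℤ_[p]) ^ b * (p : ℤ_[p]) ^ d) * (p : ℤ_[p]) ^ d := by ring
    _ = (u : ℤ_[p]) * Nat.card (W.selmerGroupPInfty p) * (p : ℤ_[p]) ^ c * (p : ℤ_[p]) ^ d := by rw [hu]
    _ = (u : ℤ_[p]) * Nat.card (W.selmerGroupPInfty p) * ((p : ℤ_[p]) ^ c * (p : ℤ_[p]) ^ d) := by ring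
    _ = (u : ℤ_[p]) * Nat.card (W.selmerGroupPInfty p) * ((p : ℤ_[p]) ^ a * (p : ℤ_[p]) ^ b) := by rw [hpow]
    _ = (u : ℤ_[p]) * Nat.card (W.selmerGroupPInfty p) * (p : ℤ_[p]) ^ a * (p : ℤ_[p]) ^ b := by ring


/-! ## §2 Good ordinary `p`: every input but the reverse inequality discharged -/

/-- **Greenberg's Thm. 4.1 over `ℚ` at a GOOD ORDINARY `p`, ANY rational `p`-torsion, TWO-SIDED modulo the reverse inequality
`hrev` at one auxiliary place `v₀ ∉ S`:** `X` is finitely generated `Λ`-torsion and **`f(0) · #E(ℚ)(p)² = u · #Sel_{p^∞}(E/ℚ) ·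
∏_{v ∈ S} #𝒦_{v,0}[p^∞]`, `u ∈ ℤ_pˣ`** — §1 with «DIV» (k4-p1 `InputsGreenbergShaTwoAnyTorsion.forall_exists_conjH1_sub_eq_real`),
Greenberg's local surjectivity at every finite place (k4-p1 `InputsGreenbergLocalAtP.exists_primary_resOfLe_eq_of_forall_conjH1_eq_all`)
and Lemma 3.4 at `n = 0` (`InputsGreenbergLemma34.lemma34_rat_zero`). [cite: GreenbergLNM1716, Thm. 4.1 (p. 102), §4 pp. 104–108] -/
theorem constantCoeff_mul_sq_eq_ordinary_rat_of_reverse (p : ℕ) [hp : Fact p.Prime] (W : WeierstrassCurve ℚ)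
    [W.IsGloballyMinimal] [W.IsElliptic] (hgo : GoodOrd W p) (κ : ZpExtension ℚ p) (hκ : κ.IsCyclotomic)
    {γ : absoluteGaloisGroup ℚ} (hγ : κ.IsTopGenerator γ) (D : W.SelmerDualData κ γ) [Finite (W.selmerGroupPInfty p)]
    (S : Finset (HeightOneSpectrum (𝓞 ℚ))) (hS : ∀ v ∉ S, ((p : ℕ) : 𝓞 ℚ) ∉ v.asIdeal ∧ W.HasGoodReductionAt v)
    (v₀ : HeightOneSpectrum (𝓞 ℚ)) (hv₀ : v₀ ∉ S)
    (hrev : Nat.card (W.KerG κ 0) *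
        Nat.card (AddCommGroup.primaryComponent
            (discreteH1 (localSubgroup (⊤ : Subgroup (absoluteGaloisGroup ℚ)) (v₀.adicCompletion ℚ))
              (localPoints W (v₀.adicCompletion ℚ))) p ⧸
          (AddSubgroup.map (W.localResOver p ⊤ (v₀.adicCompletion ℚ))
            (unramifiedOutside (⊤ : Subgroup (absoluteGaloisGroup ℚ)) (W.geomPrimaryTorsion p) p
                ((↑S : Set (HeightOneSpectrum (𝓞 ℚ))) ∪ {v₀}) ⊓
              (⨅ v ∈ S, W.localKerOver p ⊤ (v.adicCompletion ℚ)) ⊓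
              (⨅ w : InfinitePlace ℚ, W.localKerOver p ⊤ w.Completion))).addSubgroupOf
            (AddCommGroup.primaryComponent
              (discreteH1 (localSubgroup (⊤ : Subgroup (absoluteGaloisGroup ℚ)) (v₀.adicCompletion ℚ))
                (localPoints W (v₀.adicCompletion ℚ))) p)) ≤
      (∏ v ∈ S, Nat.card (W.localTowerKerPrimary κ (v.adicCompletion ℚ) 0)) *
        Nat.card (EndCoinvariants (W.conjSelmerInfty κ γ - 1)))
    (f : IwasawaAlgebra p) (hf : Module.charIdeal (IwasawaAlgebra p) D.X = Ideal.span {f}) :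
    Module.Finite (IwasawaAlgebra p) D.X ∧ Module.IsTorsion (IwasawaAlgebra p) D.X ∧
      ∃ u : ℤ_[p]ˣ, PowerSeries.constantCoeff f *
          (Nat.card (AddCommGroup.primaryComponent W.toAffine.Point p) : ℤ_[p]) ^ 2 =
        (u : ℤ_[p]) * Nat.card (W.selmerGroupPInfty p) *
          ∏ v ∈ S, Nat.card (W.localTowerKerPrimary κ (v.adicCompletion ℚ) 0) := by
  have hord : IsOrdinaryAt W p := hgo
  exact constantCoeff_mul_sq_eq_rat_of_reverse p W κ hκ hγ D
    (InputsGreenbergShaTwoAnyTorsion.forall_exists_conjH1_sub_eq_real W p κ hγ)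
    (fun v c hc hfix ↦ InputsGreenbergLocalAtP.exists_primary_resOfLe_eq_of_forall_conjH1_eq_all W hgo κ hκ v c hc hfix)
    (fun v hpv ↦ (InputsGreenbergLemma34.lemma34_rat_zero W p hord κ hκ v hpv).1) S hS v₀ hv₀ hrev f hf

/-! ## §3 The NON-SPLIT multiplicative twin -/

/-- **Greenberg's «analogue of Thm. 4.1» over `ℚ` at a NON-SPLIT multiplicative `p`, ANY rational `p`-torsion, TWO-SIDED modulo
the reverse inequality at one auxiliary place `v₀ ∉ S`:** `X` is finitely generated `Λ`-torsion and **`f(0) · #E(ℚ)(p)² =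
u · #Sel_{p^∞}(E/ℚ) · ∏_{v ∈ S} #𝒦_{v,0}[p^∞]`, `u ∈ ℤ_pˣ`** — §1 with «DIV» (k4-p1), the local surjectivity at every finite place
(GEN 29 `MultLocSurj.exists_primary_resOfLe_eq_of_forall_conjH1_eq_all_nonsplit`) and the finiteness of `𝒦_{v,0}` above `p`
(GEN 28 `MultTowerControl.exists_natCard_localTowerKerPrimary_le_multiplicative`).
[cite: GreenbergLNM1716, Thm. 4.1 (p. 102), §4 pp. 104–108 and 112–113] -/
theorem constantCoeff_mul_sq_eq_nonsplit_rat_of_reverse (p : ℕ) [hp : Fact p.Prime] (W : WeierstrassCurve ℚ)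
    [W.IsGloballyMinimal] [W.IsElliptic] (hmult : W.HasMultiplicativeReductionAtPrime p)
    (hns : ¬ W.HasSplitMultiplicativeReductionAtPrime p) (κ : ZpExtension ℚ p) (hκ : κ.IsCyclotomic)
    {γ : absoluteGaloisGroup ℚ} (hγ : κ.IsTopGenerator γ) (D : W.SelmerDualData κ γ) [Finite (W.selmerGroupPInfty p)]
    (S : Finset (HeightOneSpectrum (𝓞 ℚ))) (hS : ∀ v ∉ S, ((p : ℕ) : 𝓞 ℚ) ∉ v.asIdeal ∧ W.HasGoodReductionAt v)
    (v₀ : HeightOneSpectrum (𝓞 ℚ)) (hv₀ : v₀ ∉ S)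
    (hrev : Nat.card (W.KerG κ 0) *
        Nat.card (AddCommGroup.primaryComponent
            (discreteH1 (localSubgroup (⊤ : Subgroup (absoluteGaloisGroup ℚ)) (v₀.adicCompletion ℚ))
              (localPoints W (v₀.adicCompletion ℚ))) p ⧸
          (AddSubgroup.map (W.localResOver p ⊤ (v₀.adicCompletion ℚ))
            (unramifiedOutside (⊤ : Subgroup (absoluteGaloisGroup ℚ)) (W.geomPrimaryTorsion p) p
                ((↑S : Set (HeightOneSpectrum (𝓞 ℚ))) ∪ {v₀}) ⊓
              (⨅ v ∈ S, W.localKerOver p ⊤ (v.adicCompletion ℚ)) ⊓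
              (⨅ w : InfinitePlace ℚ, W.localKerOver p ⊤ w.Completion))).addSubgroupOf
            (AddCommGroup.primaryComponent
              (discreteH1 (localSubgroup (⊤ : Subgroup (absoluteGaloisGroup ℚ)) (v₀.adicCompletion ℚ))
                (localPoints W (v₀.adicCompletion ℚ))) p)) ≤
      (∏ v ∈ S, Nat.card (W.localTowerKerPrimary κ (v.adicCompletion ℚ) 0)) *
        Nat.card (EndCoinvariants (W.conjSelmerInfty κ γ - 1)))
    (f : IwasawaAlgebra p) (hf : Module.charIdeal (IwasawaAlgebra p) D.X = Ideal.span {f}) :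
    Module.Finite (IwasawaAlgebra p) D.X ∧ Module.IsTorsion (IwasawaAlgebra p) D.X ∧
      ∃ u : ℤ_[p]ˣ, PowerSeries.constantCoeff f *
          (Nat.card (AddCommGroup.primaryComponent W.toAffine.Point p) : ℤ_[p]) ^ 2 =
        (u : ℤ_[p]) * Nat.card (W.selmerGroupPInfty p) *
          ∏ v ∈ S, Nat.card (W.localTowerKerPrimary κ (v.adicCompletion ℚ) 0) :=
  constantCoeff_mul_sq_eq_rat_of_reverse p W κ hκ hγ D
    (InputsGreenbergShaTwoAnyTorsion.forall_exists_conjH1_sub_eq_real W p κ hγ)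
    (fun v c hc hfix ↦ MultLocSurj.exists_primary_resOfLe_eq_of_forall_conjH1_eq_all_nonsplit W hmult hns κ v c hc hfix)
    (fun v hpv ↦ by
      obtain ⟨B, hB⟩ := MultTowerControl.exists_natCard_localTowerKerPrimary_le_multiplicative W hmult κ hκ v hpv
      exact (hB 0).1) S hS v₀ hv₀ hrev f hf

end Summit.BirchSwinnertonDyer.BirchSwinnertonDyer.Theorems.TorsionEulerChar

end
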